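import Summits.QuantumFields.YangMills.Theorems.ScalingWindowSplitCurvatureAmnesiaWilsonSchwingerDyson
import Literature.MathematicalPhysics.QuantumFieldTheory.YangMillsOS
import HarnessLib

/-!
# The one-link shift-derivative of the translated Wilson action density (crux stmt-QuantumFields-16192, line `WardDefectSketch`)

Support file for the crux item stmt-QuantumFields-16192 (`CoincidenceRotationBootstrap.CurvatureAmnesia`),
line `WardDefectSketch`, step (W-exact b2) of the lattice rotation-Ward engine: the registered sub-goal
`hasDerivAt_actionDensity_torusLift_oneLink`.

The Schwinger–Dyson (integration-by-parts) identity of Wilson's torus measure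
(`SchwingerDyson.wilson_schwingerDyson_oneLink`, `∫ f' dμ_β = β ∫ f S' dμ_β`) consumes observables `f` that are
differentiable along the one-link left shift `U ↦ U[e ↦ k(t) U_e]` together with their derivative `f'`.  The
observables of the line are products of smeared CURVATURE fields
`Φ(f)(Ũ) = c a⁴ Σ_y f(a y) (actionDensity ρ (τ_y Ũ) − m)`, `Ũ = torusLift S U` the periodic lift of a torus
configuration and `τ_y = configShift (-y)` the lattice translation; this file computes their building block,
the shift-derivative of ONE translated action density:

* `ActionDensityDeriv.actionDensity_configShift_torusLift`: the translated action density of the periodic lift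
  is the sum over the six coordinate planes `i < j` of `Re tr ρ(U_p)`, `p` the TORUS plaquette at
  `Torus.proj S y` (bridges `plaquetteObs ρ 0 i j (τ_y V) = plaquetteObs ρ y i j V` and
  `FreeEnergy.plaquetteHolonomyZd_torusLift`);
* `hasDerivAt_actionDensity_torusLift_oneLink` (registered signature, verbatim): along the shift with
  `ρ(k(t)) = exp(tX)` the translated action density is differentiable at `t = 0`, with derivative the sum over
  the six planes of `Re tr` of the four-term Leibniz sums of `SchwingerDyson.hasDerivAt_rho_holonomy`;
* `hasDerivAt_smearedLatticeField_actionDensity_oneLink`: the smeared curvature field `Φ(f)` inherits the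
  derivative `c a⁴ Σ_{y ∈ Λ} f(a y) · (the above at y)` (linearity).

Everything is elementary (Mathlib `HasDerivAt.fun_sum`, `HasDerivAt.const_mul`, `HasDerivAt.sub_const`);
no definitions, no notation.  References: folklore (product rule); M. Creutz, *Quarks, gluons and lattices*
(1983), Ch. 11 for the Schwinger–Dyson equations of lattice gauge theory.
-/

noncomputable section

namespace Summit.QuantumFields.YangMills.Cruxes.CurvatureAmnesia.WardDefect

open scoped BigOperators Topology
open Filter MeasureTheory
open Literature.MathematicalPhysics.QuantumLattice Literature.MathematicalPhysics.AQFT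
  Literature.MathematicalPhysics.QuantumFieldTheory

namespace ActionDensityDeriv

/-! ### Translated plaquette observables of the periodic lift -/

section Bridge

variable {d N : ℕ} {G : Type} [Group G] [MeasurableSpace G]

/-- The plaquette holonomy at the origin of the translate `τ_x V = configShift (-x) V` is the plaquette
holonomy of `V` at `x` (design identity of the translation convention). [folklore] -/
theorem plaquetteHolonomyZd_configShift_neg_zero (x : Literature.Probability.LatticeModels.Site d)
    (V : LGConfig d G) (i j : Fin d) :
    plaquetteHolonomyZd (configShift (-x) V) 0 i j = plaquetteHolonomyZd V x i j := by
  simp only [plaquetteHolonomyZd, configShift_apply, zero_add, sub_neg_eq_add, zero_add]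
  rw [add_comm (Pi.single i 1) x, add_comm (Pi.single j 1) x]

/-- `plaquetteObs ρ 0 i j (τ_x V) = plaquetteObs ρ x i j V`: the plaquette observable at the origin of the
translate is the plaquette observable at `x`. [folklore] -/
theorem plaquetteObs_zero_configShift_neg (ρ : G →* Matrix (Fin N) (Fin N) ℂ)
    (x : Literature.Probability.LatticeModels.Site d) (i j : Fin d) (V : LGConfig d G) :
    plaquetteObs ρ 0 i j (configShift (-x) V) = plaquetteObs ρ x i j V := by
  simp only [plaquetteObs, plaquetteHolonomyZd_configShift_neg_zero]

/-- The translated action density of the periodic lift of a torus configuration `V` is the sum over the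
six planes `i < j` of `Re tr ρ(V_p)`, `p` the torus plaquette at `Torus.proj S y` in the `(i, j)` plane. [folklore] -/
theorem actionDensity_configShift_torusLift (ρ : G →* Matrix (Fin N) (Fin N) ℂ) (S : ℕ)
    (V : GaugeConfig 4 S G) (y : Fin 4 → ℤ) :
    actionDensity ρ (configShift (-y) (torusLift S V)) =
      ∑ i : Fin 4, ∑ j : Fin 4, if i < j then
        (ρ (plaquetteHolonomy V (Literature.Probability.LatticeModels.Torus.proj S y) i j)).trace.re else 0 := by
  unfold actionDensity
  refine Finset.sum_congr rfl fun i _ => Finset.sum_congr rfl fun j _ => ?_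
  split_ifs
  · rw [plaquetteObs_zero_configShift_neg, plaquetteObs, FreeEnergy.plaquetteHolonomyZd_torusLift]
  · rfl

end Bridge

/-! ### The derivative of the plane sum -/

section Deriv

variable {N : ℕ} {G : Type} [Group G] (ρ : G →* Matrix (Fin N) (Fin N) ℂ) {k : ℝ → G}
  {X : Matrix (Fin N) (Fin N) ℂ}

/-- The sum over the planes `i < j` of `Re tr ρ(U_p)` at a torus site `y` is differentiable along the one-link
shift `U ↦ U[e ↦ k(t) U_e]` (`ρ(k(t)) = exp(tX)`) at `t = 0`, with derivative the plane sum of `Re tr` of the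
Leibniz sums of `SchwingerDyson.hasDerivAt_rho_holonomy`. [folklore] -/
theorem hasDerivAt_planeSum_reTrace_holonomy (hk : ∀ s t, k (s + t) = k s * k t)
    (hX : ∀ t, ρ (k t) = NormedSpace.exp ((t : ℂ) • X)) {d L : ℕ} (e : Edge d L) (U : GaugeConfig d L G)
    (y : Site d L) :
    HasDerivAt (fun t : ℝ => ∑ i : Fin d, ∑ j : Fin d, if i < j then
        (ρ (plaquetteHolonomy (Function.update U e (k t * U e)) y i j)).trace.re else 0)
      (∑ i : Fin d, ∑ j : Fin d, if i < j then
        ((((if (y, i) = e then X * ρ (U e) else 0) * ρ (U (y.shift i, j)) +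
              ρ (U (y, i)) * (if (y.shift i, j) = e then X * ρ (U e) else 0)) * ρ ((U (y.shift j, i))⁻¹) +
            ρ (U (y, i)) * ρ (U (y.shift i, j)) *
              (if (y.shift j, i) = e then ρ ((U e)⁻¹) * (-X) else 0)) * ρ ((U (y, j))⁻¹) +
          ρ (U (y, i)) * ρ (U (y.shift i, j)) * ρ ((U (y.shift j, i))⁻¹) *
            (if (y, j) = e then ρ ((U e)⁻¹) * (-X) else 0)).trace.re else 0) 0 := by
  refine HasDerivAt.fun_sum fun i _ => HasDerivAt.fun_sum fun j _ => ?_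
  by_cases hij : i < j
  · simp only [hij, if_true]
    exact SchwingerDyson.hasDerivAt_reTrace (SchwingerDyson.hasDerivAt_rho_holonomy ρ hk hX e U y i j)
  · simp only [hij, if_false]
    exact hasDerivAt_const _ _

end Deriv

end ActionDensityDeriv

open ActionDensityDeriv

/-- **(W-exact b2) Derivative of the translated action density of the periodic lift along a one-link shift**
(registered sub-goal of crux item stmt-QuantumFields-16192, line `WardDefectSketch`).  For a group `G` with a
matrix representation `ρ`, a multiplicative family `k` with `ρ(k(t)) = exp(tX)`, a torus of side `S`, an edge
`e`, a torus configuration `U` and a lattice point `y₀ ∈ ℤ⁴`: the function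
`t ↦ actionDensity ρ (τ_{y₀} (torusLift S (U[e ↦ k(t) U_e])))` is differentiable at `t = 0`, with derivative
the sum over the six planes `i < j` of `Re tr` of the four-term Leibniz sums of
`SchwingerDyson.hasDerivAt_rho_holonomy` at the torus site `Torus.proj S y₀`.  Proof: the translated action
density of the lift is the plane sum of torus plaquette traces at `Torus.proj S y₀`
(`actionDensity_configShift_torusLift`), differentiated term by term. [folklore] -/
theorem hasDerivAt_actionDensity_torusLift_oneLink : ∀ (G : Type) [Group G] [MeasurableSpace G] (N : ℕ) (ρ : G →* Matrix (Fin N) (Fin N) ℂ) (k : ℝ → G), (∀ s t : ℝ, k (s + t) = k s * k t) → ∀ (X : Matrix (Fin N) (Fin N) ℂ), (∀ t : ℝ, ρ (k t) = NormedSpace.exp ((t : ℂ) • X)) → ∀ (S : ℕ) (e : Edge 4 S) (U : GaugeConfig 4 S G) (y₀ : Fin 4 → ℤ), HasDerivAt (fun t : ℝ => actionDensity ρ (configShift (-y₀) (torusLift S (Function.update U e (k t * U e))))) (∑ i : Fin 4, ∑ j : Fin 4, if i < j then ((((if (Literature.Probability.LatticeModels.Torus.proj S y₀, i) = e then X * ρ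 (U e) else 0) * ρ (U (Site.shift (Literature.Probability.LatticeModels.Torus.proj S y₀) i, j)) + ρ (U (Literature.Probability.LatticeModels.Torus.proj S y₀, i)) * (if (Site.shift (Literature.Probability.LatticeModels.Torus.proj S y₀) i, j) = e then X * ρ (U e) else 0)) * ρ ((U (Site.shift (Literature.Probability.LatticeModels.Torus.proj S y₀) j, i))⁻¹) + ρ (U (Literature.Probability.LatticeModels.Torus.proj S y₀, i)) * ρ (U (Site.shift (Literature.Probability.LatticeModels.Torus.proj S y₀) i, j)) * (if (Site.shift (Literature.Probability.LatticeModels.Torus.proj S y₀) j, i) = e then ρ ((U e)⁻¹) * (-X) else 0)) * ρ ((U (Literature.Probability.LatticeModels.Torus.proj S y₀, j))⁻¹) + ρ (U (Literature.Probability.LatticeModels.Torus.proj S y₀, i)) * ρ (U (Site.shift (Literature.Probability.LatticeModels.Torus.proj S y₀) i, j)) * ρ ((U (Site.shift (Literature.Probability.LatticeModels.Torus.proj S y₀) j, i))⁻¹) * (if (Literature.Probability.LatticeModels.Torus.proj S y₀, j) = e then ρ ((U e)⁻¹) * (-X) else 0)).trace.re else 0) 0 := by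
  intro G _ _ N ρ k hk X hX S e U y₀
  have hfun : ∀ t : ℝ, actionDensity ρ (configShift (-y₀) (torusLift S (Function.update U e (k t * U e)))) =
      ∑ i : Fin 4, ∑ j : Fin 4, if i < j then
        (ρ (plaquetteHolonomy (Function.update U e (k t * U e))
          (Literature.Probability.LatticeModels.Torus.proj S y₀) i j)).trace.re else 0 :=
    fun t => actionDensity_configShift_torusLift ρ S _ y₀
  exact (hasDerivAt_planeSum_reTrace_holonomy ρ hk hX e U _).congr_of_eventuallyEq
    (Eventually.of_forall hfun)

/-- **Derivative of the smeared curvature field along a one-link shift.**  The smeared, rescaled, renormalised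
action density `Φ(f)(Ũ) = c a⁴ Σ_{y ∈ Λ} f(a y) (actionDensity ρ (τ_y Ũ) − m)` of the periodic lift
`Ũ = torusLift S (U[e ↦ k(t) U_e])` is differentiable at `t = 0`, with derivative
`c a⁴ Σ_{y ∈ Λ} f(a y) · D_y`, `D_y` the derivative of `hasDerivAt_actionDensity_torusLift_oneLink` at `y`
(linearity: `HasDerivAt.const_mul`, `HasDerivAt.fun_sum`, `HasDerivAt.sub_const`). [folklore] -/
theorem hasDerivAt_smearedLatticeField_actionDensity_oneLink {G : Type} [Group G] [MeasurableSpace G] {N : ℕ}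
    (ρ : G →* Matrix (Fin N) (Fin N) ℂ) {k : ℝ → G} (hk : ∀ s t : ℝ, k (s + t) = k s * k t)
    {X : Matrix (Fin N) (Fin N) ℂ} (hX : ∀ t : ℝ, ρ (k t) = NormedSpace.exp ((t : ℂ) • X))
    (Λ : Finset (Literature.Probability.LatticeModels.Site 4)) (a c m : ℝ)
    (f : SchwartzMap (EuclideanSpace ℝ (Fin 4)) ℝ) {S : ℕ} (e : Edge 4 S) (U : GaugeConfig 4 S G) :
    HasDerivAt (fun t : ℝ =>
        smearedLatticeField (actionDensity ρ) Λ a c m f (torusLift S (Function.update U e (k t * U e))))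
      (c * a ^ 4 * ∑ y ∈ Λ, f (a • siteToE y) *
        ∑ i : Fin 4, ∑ j : Fin 4, if i < j then
          ((((if (Literature.Probability.LatticeModels.Torus.proj S y, i) = e then X * ρ (U e) else 0) *
                    ρ (U (Site.shift (Literature.Probability.LatticeModels.Torus.proj S y) i, j)) +
                  ρ (U (Literature.Probability.LatticeModels.Torus.proj S y, i)) *
                    (if (Site.shift (Literature.Probability.LatticeModels.Torus.proj S y) i, j) = e then
                      X * ρ (U e) else 0)) *
                ρ ((U (Site.shift (Literature.Probability.LatticeModels.Torus.proj S y) j, i))⁻¹) +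
              ρ (U (Literature.Probability.LatticeModels.Torus.proj S y, i)) *
                  ρ (U (Site.shift (Literature.Probability.LatticeModels.Torus.proj S y) i, j)) *
                (if (Site.shift (Literature.Probability.LatticeModels.Torus.proj S y) j, i) = e then
                  ρ ((U e)⁻¹) * (-X) else 0)) *
              ρ ((U (Literature.Probability.LatticeModels.Torus.proj S y, j))⁻¹) +
            ρ (U (Literature.Probability.LatticeModels.Torus.proj S y, i)) *
                  ρ (U (Site.shift (Literature.Probability.LatticeModels.Torus.proj S y) i, j)) *
                ρ ((U (Site.shift (Literature.Probability.LatticeModels.Torus.proj S y) j, i))⁻¹) *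
              (if (Literature.Probability.LatticeModels.Torus.proj S y, j) = e then
                ρ ((U e)⁻¹) * (-X) else 0)).trace.re else 0) 0 := by
  unfold smearedLatticeField
  exact HasDerivAt.const_mul _ (HasDerivAt.fun_sum fun y _ =>
    ((hasDerivAt_actionDensity_torusLift_oneLink G N ρ k hk X hX S e U y).sub_const m).const_mul _)

end Summit.QuantumFields.YangMills.Cruxes.CurvatureAmnesia.WardDefect

end
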